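import Summits.QuantumFields.YangMills.Theorems.BalabanUVNodesKLCPrAtHierFrame
import Summits.QuantumFields.YangMills.Theorems.BalabanUVNodesKLCPrAtHierFrameGL
import Summits.QuantumFields.YangMills.Theorems.BalabanUVNodesProp4DoorsPrParam
import Summits.QuantumFields.YangMills.Theorems.BalabanUVNodesC44IterMhHierFrameGLNearOne
import HarnessLib

/-!
# THE №621 JUNCTION, RE-PINNED WITH THE FRAME DEBTS PAID — hand-KLC's §5 door PARAMETRIC in the frame constant (`…_pr_param`), the SL pin at the record's hierarchical frame
# `hierFrameDatumOfRecord` AND the GL pin at the completed datum `hierFrameGLDatumOfRecord`, BOTH with `hc`∕(hdom)∕(hnear)∕(hmap)∕(hderiv) ALL DISCHARGED (`…_hierFrameRec` ∕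
# `…_hierFrameGLRec`, `C₂ = 2.816·10¹⁷·L·N`)

Cell `pub-ymgap` ∕ `ym-nodeO-ideate`, porter lineage `ymgap-nodeO-port-PTB-1` (gen 10); director-ym g24 №628 (3) («PT-B's lineage owns (T1)∕(T2)») and №630 (2)(iii) (parametric
re-press + re-pin).  `--kind proof --supports stmt-QuantumFields-27238 --as helper`; count-neutral; NEW basename; hand-KLC's ✓`…KLCPrOfB7Prop5` and the two pins ✓`…KLCPrAtHierFrame{,GL}`
are NOT edited (deprecate-and-add).  [B7] = [Balaban1985Averaging]; [B9] = [Balaban1985BackgroundPropagators]; [B11] = [Balaban1985Variational].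

WHAT IS PROVED (0 def, 0 sorry, axioms standard; ns `Summit.QuantumFields.YangMills.Theorems.KExpOfRecordPr`):
* §1 ★★ `prop4UniformPrAtRecord_node00_of_prop5Clause_pr_param` — hand-KLC's §5 door for a datum FAMILY `𝔥` with the window constant `c𝔥 ∈ [0, 10¹⁰]` a binder and
  `C₂ := (6.4·10¹²·c𝔥 + 2.56·10¹⁶)·L·N` (glue over ✓`C44IterMh.prop4UniformPrAtRecord_node00_of_coneLetterPr_param`).
* §2 ★★★ `prop4UniformPrAtRecord_node00_of_prop5Clause_hierFrameRec` — THE SL PIN WITH NO FRAME DEBT: at `𝔥 := fun K k U₀ => hierFrameDatumOfRecord F N k U₀`, `c𝔥 := 40000`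
  (✓`hierFrameDatumOfRecord_hnear_of_regular`), (hdom) by ✓`hierFrameDatumOfRecord_hdom_of_regular` — both from print's (14), which the door already displays as `hreg` — (hmap)∕(hderiv)
  by ✓`…C44IterMhHierFrameLocality`; the displayed letters that REMAIN are exactly: `hpos`∕`hQ`, (ℓa-H)ᵖʳ `hH`, (KL-H)ᵖʳ, the (157) clause `h157` of `B7.Prop5Printed (kexpOfRecordPr F N 𝔥_rec)`
  with `r + r ≤ α₁` and the window `hq`, (KL-N)ᵖʳ, `‖J‖ ≤ nJ`, print's (14) `hreg`, `∀ x, x ∈ Ω_k`; constants `C₂ = 2.816·10¹⁷·L·N`, `c₄ = (2·10¹¹·L·N)⁻¹` (ONE number each).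
* §3 ★★★ `prop4UniformPrAtRecord_node00_of_prop5Clause_hierFrameGLRec` — THE GL PIN WITH NO FRAME DEBT: the same at `𝔥 := fun K k U₀ => hierFrameGLDatumOfRecord F N k U₀`
  ((hdom)∕(hnear) by ✓`hierFrameGLDatumOfRecord_hdom_of_regular`∕`_hnear_of_regular` — on traceless chart fields the completed frame IS A1's frame, ✓`…HierFrameGLNearOne`;
  (hmap)∕(hderiv) by ✓`…C44IterMhHierFrameGLLocality`).

HONEST FRAMING.  Glue over landed theorems; NO estimate of [B7] Prop. 5 ∕ [B9] ∕ [B11] Prop. 4 is proved here; (T1)∕(T2) are [B7] (81)∕(89)-class bookkeeping (✓`…HierFrameNearOne`),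
NOT (101)–(112)'s Hölder bounds; `B7.Prop5Printed (kexpOfRecordPr F N 𝔥_rec)` neither proved nor refuted; K0ᴬ ⟨stmt-QuantumFields-27238⟩ NOT closed; NODE O 0∕1; COUNT 8∕28 · K 1∕4
UNMOVED; finite `𝕋⁴_{L^K}` at fixed ε — NOT continuum ∕ ℝ⁴ ∕ OS ∕ Clay; **the Yang–Mills mass gap (Clay) is NOT proved by any of this.**  No `sorry`, `instance`, `notation`,
`set_option`; standard axioms.
-/

noncomputable section

open scoped Matrix Matrix.Norms.L2Operator InnerProductSpace ComplexConjugate BigOperators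

open Classical

namespace Summit.QuantumFields.YangMills.Theorems.KExpOfRecordPr

open Literature.MathematicalPhysics.QuantumFieldTheory.Balaban1983to89
open Literature.MathematicalPhysics.QuantumFieldTheory.Balaban1983to89.Node00
open Summit.QuantumFields.YangMills.Theorems.KExpOfRecord (KRecIdx kexpOfRecord)
open T4Continuum BlockAveraging
open B10Eq42TorusConstraint (bondsIn)
open B10Eq38TorusDomains (toFine)
open B11Eq103H1Complex (SiteL2K)
open B9SectCLatticeCarrier (Bond)
open B11Eq115Space (NegSup NegSize JetSup levWeight levWeight_apply)
open B11Eq90Transpose (single115)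
open B11Eq90V0primeCurrent (flat115)
open B11Eq111FrakG (nabla115)
open B15AveragingHolomorphic (iterMh)

variable (F : T4Family) (N : ℕ) [NeZero N]

/-! ## §1  hand-KLC's §5 door for a datum family, the window constant a binder -/

section Family

variable (𝔥 : ∀ (K k : ℕ) (U₀ : GaugeField (F.P K) 0 (SU N)), FrameDatum (F.P K) N k U₀)
variable (K k : ℕ) (Ω : ℕ → Set (Site (F.P K) 0)) (U₀ : GaugeField (F.P K) 0 (SU N))
variable [Fact (0 < (F.L : ℝ))] [Fact (0 < (F.P K).eta k)] [Fact (0 < c0Rec F K k)] [Fact (∀ c, 0 < wBRec F K k c)]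

/-- ★★ **hand-KLC's §5 DOOR ✓`prop4UniformPrAtRecord_node00_of_prop5Clause_pr` WITH THE WINDOW CONSTANT A BINDER** (`{c𝔥} (hc0 : 0 ≤ c𝔥) (hc : c𝔥 ≤ 10¹⁰)`,
`C₂ := (6.4·10¹²·c𝔥 + 2.56·10¹⁶)·L·N`); statement otherwise verbatim (their file untouched), proof the same glue over ✓`C44IterMh.prop4UniformPrAtRecord_node00_of_coneLetterPr_param`.
[cite: Balaban1985Variational, Prop. 4 (97)–(98) pp.292–293, (72)–(73) p.289, (86)–(89) p.291, (14) p.280; Balaban1985Averaging, Proposition 5 (157) p.42, (52) p.26, (92) p.31, (138) p.39; Balaban1985BackgroundPropagators, (3.113)–(3.114) p.418, (3.132) p.422] -/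
theorem prop4UniformPrAtRecord_node00_of_prop5Clause_pr_param [DecidableEq (PBond (F.P K) k)] (levB : PBond (F.P K) k → ℕ) (a : ℝ)
    (hpos : ∀ x, x ≠ 0 → 0 < RCLike.re ⟪x, laplaceAOfRecord F N k U₀ (QprOfRecord F N k U₀ (𝔥 K k U₀)) (QprimeOfRecord F N k U₀) a x⟫_ℂ)
    (hQ : Function.Surjective (QprOfRecord F N k U₀ (𝔥 K k U₀)))
    (Gp : SiteL2K ℂ (F.P K).d (fun _ => (F.P K).sitesPerDir 0) (c0Rec F K k) (WRec N) →ₗ[ℂ]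
      SiteL2K ℂ (F.P K).d (fun _ => (F.P K).sitesPerDir 0) (c0Rec F K k) (WRec N))
    {b α nJ : ℝ} (hkpos : 0 < k) (hkm : k ≤ (F.P K).m + (F.P K).K) (hb : 0 ≤ b) (hΩ : ∀ x, x ∈ Ω k) (hαpos : 0 < α) (hα : α * (11000000 * N) ≤ 1)
    (hreg : ∀ j, j < k → PlaqSmall (α * ((F.L : ℝ) ^ j * (F.P K).eta k) ^ 2) (Averaging.iter (avOfRecord F N K) j U₀))
    {c𝔥 : ℝ} (hc0 : 0 ≤ c𝔥) (hc : c𝔥 ≤ 10000000000)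
    (hdom : ∀ Y : PBond (F.P K) 0 → Matrix (Fin N) (Fin N) ℂ, (∀ b, (Y b).trace = 0) → (F.L : ℝ) ^ k * ‖Y‖ < 1 / (25000000000 * (F.L : ℝ) * N) →
      expOver U₀ Y ∈ (𝔥 K k U₀).dom)
    (hnear : ∀ Y : PBond (F.P K) 0 → Matrix (Fin N) (Fin N) ℂ, (∀ b, (Y b).trace = 0) → (F.L : ℝ) ^ k * ‖Y‖ < 1 / (25000000000 * (F.L : ℝ) * N) →
      ∀ y : Site (F.P K) k, ‖(𝔥 K k U₀).map (expOver U₀ Y) y - 1‖ ≤ c𝔥 * ((F.L : ℝ) ^ k * ‖Y‖) ∧ ‖(𝔥 K k U₀).inv (expOver U₀ Y) y - 1‖ ≤ c𝔥 * ((F.L : ℝ) ^ k * ‖Y‖))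
    (hmap : ∀ Y : Set (Site (F.P K) 0), (∀ i, i < k → ∀ s : Site (F.P K) i, toFine i s ∈ Y ↔ toFine (i + 1) (blockOf s) ∈ Y) →
      ∀ V V' : PBond (F.P K) 0 → Matrix (Fin N) (Fin N) ℂ, (∀ b : PBond (F.P K) 0, b ∈ bondsIn 0 Y → V b = V' b) →
      ∀ y : Site (F.P K) k, toFine k y ∈ Y → (𝔥 K k U₀).map V y = (𝔥 K k U₀).map V' y ∧ (𝔥 K k U₀).inv V y = (𝔥 K k U₀).inv V' y)
    (hderiv : ∀ Y : Set (Site (F.P K) 0), (∀ i, i < k → ∀ s : Site (F.P K) i, toFine i s ∈ Y ↔ toFine (i + 1) (blockOf s) ∈ Y) →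
      ∀ Z Z' : PBond (F.P K) 0 → Matrix (Fin N) (Fin N) ℂ, (∀ b : PBond (F.P K) 0, b ∈ bondsIn 0 Y → Z b = Z' b) →
      ∀ y : Site (F.P K) k, toFine k y ∈ Y → (𝔥 K k U₀).deriv Z y = (𝔥 K k U₀).deriv Z' y)
    (hH : Prop4LetterHPrAtRecord F N K k Ω U₀ (𝔥 K k U₀) levB a hpos hQ b)
    -- (KL-H)ᵖʳ
    {hk : Bond (F.P K).d (fun _ => (F.P K).sitesPerDir 0) → PBond (F.P K) k → ℝ} (hk0 : ∀ b' y, 0 ≤ hk b' y)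
    (hHk : ∀ (y : PBond (F.P K) k) (Z : Matrix (Fin N) (Fin N) ℂ) (b' : Bond (F.P K).d (fun _ => (F.P K).sitesPerDir 0)),
      ‖flat115 (H1prOfRecordAtBg F N K k Ω U₀ (𝔥 K k U₀) levB a hpos hQ
          ((NegSup.equiv (levWeight (F.L : ℝ) ((F.P K).eta k) levB 0) (Matrix (Fin N) (Fin N) ℂ)).symm (Pi.single y Z))) b'‖ ≤ hk b' y * ‖Z‖)
    {ΘH : ℝ} (hΘH : 0 ≤ ΘH) (hH1 : ∀ y, ∑ b', hk b' y ≤ ΘH) {ΘHw : ℝ} (hΘHw : 0 ≤ ΘHw)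
    (hHw : ∀ (bb : Bond (F.P K).d (fun _ => (F.P K).sitesPerDir 0)) (y : PBond (F.P K) k),
      ∑ b', levWeight (F.L : ℝ) ((F.P K).eta k) (bondLevLit F Ω k) 3 bb / levWeight (F.L : ℝ) ((F.P K).eta k) (bondLevLit F Ω k) 3 b' * hk b' y ≤ ΘHw)
    -- (KL-C)ᵖʳ := the (157) clause of `B7.Prop5Printed (kexpOfRecordPr F N 𝔥)` at `(α, α₁, C₃)`, `r + r ≤ α₁`, and the window
    {C₃ α₁ : ℝ} (hC₃ : 0 ≤ C₃)
    (h157 : ∀ (i : KRecIdx F) (U₀ : (kexpOfRecordPr F N 𝔥 i).Cfg), (kexpOfRecordPr F N 𝔥 i).plaqDevEta U₀ < α →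
      ∀ A : (kexpOfRecordPr F N 𝔥 i).Fld, (kexpOfRecordPr F N 𝔥 i).fldNorm A < α₁ → (kexpOfRecordPr F N 𝔥 i).dCk U₀ A ≤ C₃ * (kexpOfRecordPr F N 𝔥 i).fldNorm A)
    (hrα₁ : letI C₂ : ℝ := (6400000000000 * c𝔥 + 25600000000000000) * (F.L : ℝ) * N
      letI c₄ : ℝ := 1 / (200000000000 * (F.L : ℝ) * N)
      letI r : ℝ := min (c₄ / 4) (min (1 / 2) (1 / (16 * (b * C₂ + 1))))
      r + r ≤ α₁)
    (hq : letI C₂ : ℝ := (6400000000000 * c𝔥 + 25600000000000000) * (F.L : ℝ) * N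
      letI c₄ : ℝ := 1 / (200000000000 * (F.L : ℝ) * N)
      letI r : ℝ := min (c₄ / 4) (min (1 / 2) (1 / (16 * (b * C₂ + 1))))
      (r + r) * ΘH * (2 * ((F.P K).d : ℝ) * (C₃ * (F.P K).eta k ^ (F.P K).d)) ≤ 1 / 2)
    -- (KL-N)ᵖʳ
    {hk' : Bond (F.P K).d (fun _ => (F.P K).sitesPerDir 0) → PBond (F.P K) k → ℝ} (hk'0 : ∀ b' y, 0 ≤ hk' b' y)
    (hNk : ∀ (y : PBond (F.P K) k) (Z : Matrix (Fin N) (Fin N) ℂ) (b' : Bond (F.P K).d (fun _ => (F.P K).sitesPerDir 0)),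
      ‖NegSup.equiv (levWeight (F.L : ℝ) ((F.P K).eta k) (bondLevLit F Ω k) 3) (Matrix (Fin N) (Fin N) ℂ)
        (DeltaPiCurOfRecord F N K k Ω U₀ Gp (QprimeOfRecord F N k U₀) (H1prOfRecordAtBg F N K k Ω U₀ (𝔥 K k U₀) levB a hpos hQ
          ((NegSup.equiv (levWeight (F.L : ℝ) ((F.P K).eta k) levB 0) (Matrix (Fin N) (Fin N) ℂ)).symm (Pi.single y Z)))) b'‖ ≤ hk' b' y * ‖Z‖)
    {Θ' : ℝ} (hΘ'0 : 0 ≤ Θ')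
    (hΘ' : ∀ (bb : Bond (F.P K).d (fun _ => (F.P K).sitesPerDir 0)) (y : PBond (F.P K) k),
      ∑ b', levWeight (F.L : ℝ) ((F.P K).eta k) (bondLevLit F Ω k) 3 bb / levWeight (F.L : ℝ) ((F.P K).eta k) (bondLevLit F Ω k) 1 b' * hk' b' y ≤ Θ')
    {N₁ : ℝ} (hN₁0 : 0 ≤ N₁)
    (hN₁ : ∀ b', ∑ y, levWeight (F.L : ℝ) ((F.P K).eta k) (bondLevLit F Ω k) 3 b' / levWeight (F.L : ℝ) ((F.P K).eta k) levB 0 y * hk' b' y ≤ N₁)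
    (hJ : ‖JOfRecordAtBg F N K k Ω U₀‖ ≤ nJ) :
    letI C₂ : ℝ := (6400000000000 * c𝔥 + 25600000000000000) * (F.L : ℝ) * N
    letI c₄ : ℝ := 1 / (200000000000 * (F.L : ℝ) * N)
    letI r : ℝ := min (c₄ / 4) (min (1 / 2) (1 / (16 * (b * C₂ + 1))))
    letI R' : ℝ := min r ((1 - 4 * b * C₂ * (r + r)) * (1 / 16))
    letI CV : ℝ := 1024 * (((F.P K).d - 1 : ℕ) : ℝ) * ((1 : ℝ) * 1) ^ 3 * N * (α * (1 : ℝ) ^ 2 + 1 / 16)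
        + (((F.P K).d - 1 : ℕ) : ℝ) * ((1 : ℝ) * 1) ^ 3 * (136 + 2 * ((1 : ℝ) * 1)) * N
    letI G : ℝ := 2 * ((F.P K).d : ℝ) * (C₃ * (F.P K).eta k ^ (F.P K).d)
    letI θ₃ : ℝ := (2 * (1 / (1 - 4 * b * C₂ * (r + r))) + 1) * ΘHw * G / r
    letI θE : ℝ := 2 * ΘHw * G * (1 / (1 - 4 * b * C₂ * (r + r)))
    letI θE' : ℝ := 2 * Θ' * G * (1 / (1 - 4 * b * C₂ * (r + r)))
    Prop4UniformPrAtRecord F N K k Ω U₀ (𝔥 K k U₀) levB a hpos hQ r Gp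
      ((N * θ₃ * nJ + (N₁ * C₂ * (1 / (1 - 4 * b * C₂ * (r + r))) ^ 2 + N * θE')
        + N * θE * (N₁ * C₂ * (1 / (1 - 4 * b * C₂ * (r + r))) ^ 2) * R'
        + N * (1 + θE * R') * CV * (1 / (1 - 4 * b * C₂ * (r + r))) ^ 2)) R' :=
  C44IterMh.prop4UniformPrAtRecord_node00_of_coneLetterPr_param F N K k Ω U₀ (𝔥 K k U₀) levB a hpos hQ Gp hkpos hkm hb hΩ hαpos.le hα hreg hc0 hc hdom hnear hmap hderiv hH hk0 hHk hΘH hH1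
    hΘHw hHw (mul_nonneg hC₃ (pow_pos Fact.out _).le)
    (fun A hA bb X c _ => coneLetter_of_prop5Clause_pr F N 𝔥 hkm levB hΩ hC₃ hαpos h157 (C44IterMh.plaqSmall_base_of_hreg F N U₀ hkpos hreg) A (lt_of_lt_of_le hA hrα₁) bb X c)
    hq hk'0 hNk hΘ'0 hΘ' hN₁0 hN₁ hJ

end Family

/-! ## §2  The SL pin at the record's hierarchical frame, every frame debt discharged -/

section Prop4

variable (K k : ℕ) (Ω : ℕ → Set (Site (F.P K) 0)) (U₀ : GaugeField (F.P K) 0 (SU N))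
variable [Fact (0 < (F.L : ℝ))] [Fact (0 < (F.P K).eta k)] [Fact (0 < c0Rec F K k)] [Fact (∀ c, 0 < wBRec F K k c)]

/-- ★★★ **[B11] PROP. 4 (97)–(98) AT THE RECORD (NODE-00) ON THE CHART FRAMED BY THE RECORD'S HIERARCHICAL FRAME, (KL-C)^{pr} BLOCK := [B7] PROP. 5 (157), NO FRAME DEBT** —
§1's door at `𝔥 := fun K k U₀ => hierFrameDatumOfRecord F N k U₀` with `c𝔥 := 40000` and ALL FIVE frame debts DISCHARGED by theorems: (hdom) ✓`hierFrameDatumOfRecord_hdom_of_regular`,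
(hnear) ✓`hierFrameDatumOfRecord_hnear_of_regular` ((T1)∕(T2) from print's (14) = the `hreg` the door displays anyway), (hmap)∕(hderiv) ✓`…C44IterMhHierFrameLocality`.  Remaining
DISPLAYED letters, verbatim: `hpos`∕`hQ` at `QprOfRecord … (hierFrameDatumOfRecord …)`, (ℓa-H)ᵖʳ `hH`, (KL-H)ᵖʳ, (KL-N)ᵖʳ, `‖J‖ ≤ nJ`, the (157) clause `h157` of
`B7.Prop5Printed (kexpOfRecordPr F N 𝔥_rec)` with `r + r ≤ α₁` and the window `hq`, print's (14) `hreg`, `∀ x, x ∈ Ω_k`; constants `C₂ = 2.816·10¹⁷·L·N`, `c₄ = (2·10¹¹·L·N)⁻¹`.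
HONEST: glue; NO estimate of [B7] Prop. 5 ∕ [B9] ∕ [B11] is proved here.
[cite: Balaban1985Variational, Prop. 4 (97)–(98) pp.292–293, (72)–(73) p.289, (86)–(89) p.291, (14) p.280; Balaban1985Averaging, Proposition 5 (157) p.42, (52) p.26, (81) p.30, (84)–(89) pp.30–31, (92) p.31, (138) p.39; Balaban1985BackgroundPropagators, (3.113)–(3.114) p.418, (3.132) p.422] -/
theorem prop4UniformPrAtRecord_node00_of_prop5Clause_hierFrameRec [DecidableEq (PBond (F.P K) k)] (levB : PBond (F.P K) k → ℕ) (a : ℝ)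
    (hpos : ∀ x, x ≠ 0 → 0 < RCLike.re ⟪x, laplaceAOfRecord F N k U₀ (QprOfRecord F N k U₀ (hierFrameDatumOfRecord F N k U₀)) (QprimeOfRecord F N k U₀) a x⟫_ℂ)
    (hQ : Function.Surjective (QprOfRecord F N k U₀ (hierFrameDatumOfRecord F N k U₀)))
    (Gp : SiteL2K ℂ (F.P K).d (fun _ => (F.P K).sitesPerDir 0) (c0Rec F K k) (WRec N) →ₗ[ℂ]
      SiteL2K ℂ (F.P K).d (fun _ => (F.P K).sitesPerDir 0) (c0Rec F K k) (WRec N))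
    {b α nJ : ℝ} (hkpos : 0 < k) (hkm : k ≤ (F.P K).m + (F.P K).K) (hb : 0 ≤ b) (hΩ : ∀ x, x ∈ Ω k) (hαpos : 0 < α) (hα : α * (11000000 * N) ≤ 1)
    (hreg : ∀ j, j < k → PlaqSmall (α * ((F.L : ℝ) ^ j * (F.P K).eta k) ^ 2) (Averaging.iter (avOfRecord F N K) j U₀))
    (hH : Prop4LetterHPrAtRecord F N K k Ω U₀ (hierFrameDatumOfRecord F N k U₀) levB a hpos hQ b)
    -- (KL-H)ᵖʳ
    {hk : Bond (F.P K).d (fun _ => (F.P K).sitesPerDir 0) → PBond (F.P K) k → ℝ} (hk0 : ∀ b' y, 0 ≤ hk b' y)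
    (hHk : ∀ (y : PBond (F.P K) k) (Z : Matrix (Fin N) (Fin N) ℂ) (b' : Bond (F.P K).d (fun _ => (F.P K).sitesPerDir 0)),
      ‖flat115 (H1prOfRecordAtBg F N K k Ω U₀ (hierFrameDatumOfRecord F N k U₀) levB a hpos hQ
          ((NegSup.equiv (levWeight (F.L : ℝ) ((F.P K).eta k) levB 0) (Matrix (Fin N) (Fin N) ℂ)).symm (Pi.single y Z))) b'‖ ≤ hk b' y * ‖Z‖)
    {ΘH : ℝ} (hΘH : 0 ≤ ΘH) (hH1 : ∀ y, ∑ b', hk b' y ≤ ΘH) {ΘHw : ℝ} (hΘHw : 0 ≤ ΘHw)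
    (hHw : ∀ (bb : Bond (F.P K).d (fun _ => (F.P K).sitesPerDir 0)) (y : PBond (F.P K) k),
      ∑ b', levWeight (F.L : ℝ) ((F.P K).eta k) (bondLevLit F Ω k) 3 bb / levWeight (F.L : ℝ) ((F.P K).eta k) (bondLevLit F Ω k) 3 b' * hk b' y ≤ ΘHw)
    -- (KL-C)ᵖʳ := the (157) clause of `B7.Prop5Printed (kexpOfRecordPr F N 𝔥_rec)` at `(α, α₁, C₃)`, `r + r ≤ α₁`, and the window
    {C₃ α₁ : ℝ} (hC₃ : 0 ≤ C₃)
    (h157 : ∀ (i : KRecIdx F) (U₀ : (kexpOfRecordPr F N (fun K k (U₀ : GaugeField (F.P K) 0 (SU N)) => hierFrameDatumOfRecord F N k U₀) i).Cfg), (kexpOfRecordPr F N (fun K k (U₀ : GaugeField (F.P K) 0 (SU N)) => hierFrameDatumOfRecord F N k U₀) i).plaqDevEta U₀ < α →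
      ∀ A : (kexpOfRecordPr F N (fun K k (U₀ : GaugeField (F.P K) 0 (SU N)) => hierFrameDatumOfRecord F N k U₀) i).Fld, (kexpOfRecordPr F N (fun K k (U₀ : GaugeField (F.P K) 0 (SU N)) => hierFrameDatumOfRecord F N k U₀) i).fldNorm A < α₁ → (kexpOfRecordPr F N (fun K k (U₀ : GaugeField (F.P K) 0 (SU N)) => hierFrameDatumOfRecord F N k U₀) i).dCk U₀ A ≤ C₃ * (kexpOfRecordPr F N (fun K k (U₀ : GaugeField (F.P K) 0 (SU N)) => hierFrameDatumOfRecord F N k U₀) i).fldNorm A)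
    (hrα₁ : letI C₂ : ℝ := 281600000000000000 * (F.L : ℝ) * N
      letI c₄ : ℝ := 1 / (200000000000 * (F.L : ℝ) * N)
      letI r : ℝ := min (c₄ / 4) (min (1 / 2) (1 / (16 * (b * C₂ + 1))))
      r + r ≤ α₁)
    (hq : letI C₂ : ℝ := 281600000000000000 * (F.L : ℝ) * N
      letI c₄ : ℝ := 1 / (200000000000 * (F.L : ℝ) * N)
      letI r : ℝ := min (c₄ / 4) (min (1 / 2) (1 / (16 * (b * C₂ + 1))))
      (r + r) * ΘH * (2 * ((F.P K).d : ℝ) * (C₃ * (F.P K).eta k ^ (F.P K).d)) ≤ 1 / 2)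
    -- (KL-N)ᵖʳ
    {hk' : Bond (F.P K).d (fun _ => (F.P K).sitesPerDir 0) → PBond (F.P K) k → ℝ} (hk'0 : ∀ b' y, 0 ≤ hk' b' y)
    (hNk : ∀ (y : PBond (F.P K) k) (Z : Matrix (Fin N) (Fin N) ℂ) (b' : Bond (F.P K).d (fun _ => (F.P K).sitesPerDir 0)),
      ‖NegSup.equiv (levWeight (F.L : ℝ) ((F.P K).eta k) (bondLevLit F Ω k) 3) (Matrix (Fin N) (Fin N) ℂ)
        (DeltaPiCurOfRecord F N K k Ω U₀ Gp (QprimeOfRecord F N k U₀) (H1prOfRecordAtBg F N K k Ω U₀ (hierFrameDatumOfRecord F N k U₀) levB a hpos hQ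
          ((NegSup.equiv (levWeight (F.L : ℝ) ((F.P K).eta k) levB 0) (Matrix (Fin N) (Fin N) ℂ)).symm (Pi.single y Z)))) b'‖ ≤ hk' b' y * ‖Z‖)
    {Θ' : ℝ} (hΘ'0 : 0 ≤ Θ')
    (hΘ' : ∀ (bb : Bond (F.P K).d (fun _ => (F.P K).sitesPerDir 0)) (y : PBond (F.P K) k),
      ∑ b', levWeight (F.L : ℝ) ((F.P K).eta k) (bondLevLit F Ω k) 3 bb / levWeight (F.L : ℝ) ((F.P K).eta k) (bondLevLit F Ω k) 1 b' * hk' b' y ≤ Θ')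
    {N₁ : ℝ} (hN₁0 : 0 ≤ N₁)
    (hN₁ : ∀ b', ∑ y, levWeight (F.L : ℝ) ((F.P K).eta k) (bondLevLit F Ω k) 3 b' / levWeight (F.L : ℝ) ((F.P K).eta k) levB 0 y * hk' b' y ≤ N₁)
    (hJ : ‖JOfRecordAtBg F N K k Ω U₀‖ ≤ nJ) :
    letI C₂ : ℝ := 281600000000000000 * (F.L : ℝ) * N
    letI c₄ : ℝ := 1 / (200000000000 * (F.L : ℝ) * N)
    letI r : ℝ := min (c₄ / 4) (min (1 / 2) (1 / (16 * (b * C₂ + 1))))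
    letI R' : ℝ := min r ((1 - 4 * b * C₂ * (r + r)) * (1 / 16))
    letI CV : ℝ := 1024 * (((F.P K).d - 1 : ℕ) : ℝ) * ((1 : ℝ) * 1) ^ 3 * N * (α * (1 : ℝ) ^ 2 + 1 / 16)
        + (((F.P K).d - 1 : ℕ) : ℝ) * ((1 : ℝ) * 1) ^ 3 * (136 + 2 * ((1 : ℝ) * 1)) * N
    letI G : ℝ := 2 * ((F.P K).d : ℝ) * (C₃ * (F.P K).eta k ^ (F.P K).d)
    letI θ₃ : ℝ := (2 * (1 / (1 - 4 * b * C₂ * (r + r))) + 1) * ΘHw * G / r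
    letI θE : ℝ := 2 * ΘHw * G * (1 / (1 - 4 * b * C₂ * (r + r)))
    letI θE' : ℝ := 2 * Θ' * G * (1 / (1 - 4 * b * C₂ * (r + r)))
    Prop4UniformPrAtRecord F N K k Ω U₀ (hierFrameDatumOfRecord F N k U₀) levB a hpos hQ r Gp
      ((N * θ₃ * nJ + (N₁ * C₂ * (1 / (1 - 4 * b * C₂ * (r + r))) ^ 2 + N * θE')
        + N * θE * (N₁ * C₂ * (1 / (1 - 4 * b * C₂ * (r + r))) ^ 2) * R'
        + N * (1 + θE * R') * CV * (1 / (1 - 4 * b * C₂ * (r + r))) ^ 2)) R' := by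
  have e : (6400000000000 * (40000 : ℝ) + 25600000000000000) * (F.L : ℝ) * N = 281600000000000000 * (F.L : ℝ) * N := by norm_num
  have h := prop4UniformPrAtRecord_node00_of_prop5Clause_pr_param F N (fun K k (U₀ : GaugeField (F.P K) 0 (SU N)) => hierFrameDatumOfRecord F N k U₀) K k Ω U₀ levB a hpos hQ
    Gp hkpos hkm hb hΩ hαpos hα hreg (c𝔥 := 40000) (by norm_num) (by norm_num)
    (C44IterMh.hierFrameDatumOfRecord_hdom_of_regular F N k U₀ hαpos.le hα hreg) (C44IterMh.hierFrameDatumOfRecord_hnear_of_regular F N k U₀ hαpos.le hα hreg)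
    (C44IterMh.hierFrameDatumOfRecord_map_inv_congr_of_eqOn_bondsIn F N k U₀ hkm) (C44IterMh.hierFrameDatumOfRecord_deriv_congr_of_eqOn_bondsIn F N k U₀ hkm)
    hH hk0 hHk hΘH hH1 hΘHw hHw hC₃ h157 (by rw [e]; exact hrα₁) (by rw [e]; exact hq) hk'0 hNk hΘ'0 hΘ' hN₁0 hN₁ hJ
  rw [e] at h
  exact h

end Prop4

/-! ## §3  The GL pin at the record's completed hierarchical frame, every frame debt discharged -/

section Prop4GL

variable (K k : ℕ) (Ω : ℕ → Set (Site (F.P K) 0)) (U₀ : GaugeField (F.P K) 0 (SU N))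
variable [Fact (0 < (F.L : ℝ))] [Fact (0 < (F.P K).eta k)] [Fact (0 < c0Rec F K k)] [Fact (∀ c, 0 < wBRec F K k c)]

/-- ★★★ **[B11] PROP. 4 (97)–(98) AT THE RECORD (NODE-00) ON THE CHART FRAMED BY THE RECORD'S COMPLETED (`GL`) HIERARCHICAL FRAME, (KL-C)^{pr} BLOCK := [B7] PROP. 5 (157),
NO FRAME DEBT** — §1's door at `𝔥 := fun K k U₀ => hierFrameGLDatumOfRecord F N k U₀` with `c𝔥 := 40000` and ALL FIVE frame debts DISCHARGED: (hdom)∕(hnear)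
✓`hierFrameGLDatumOfRecord_hdom_of_regular`∕`_hnear_of_regular` (on traceless chart fields `σ = 0` and the completed frame is A1's), (hmap)∕(hderiv) ✓`…C44IterMhHierFrameGLLocality`.
Remaining DISPLAYED letters as in §2 (with `QprOfRecord … (hierFrameGLDatumOfRecord …)`); constants `C₂ = 2.816·10¹⁷·L·N`, `c₄ = (2·10¹¹·L·N)⁻¹`.  HONEST: glue; NO estimate of
[B7] Prop. 5 ∕ [B9] ∕ [B11] is proved here.
[cite: Balaban1985Variational, Prop. 4 (97)–(98) pp.292–293, (72)–(73) p.289, (86)–(89) p.291, (14) p.280, p.307; Balaban1985Averaging, Proposition 5 (157) p.42, (52) p.26, (81) p.30, (84)–(88) pp.30–31, (92) p.31, (138) p.39; Balaban1985BackgroundPropagators, (3.113)–(3.114) p.418, (3.132) p.422] -/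
theorem prop4UniformPrAtRecord_node00_of_prop5Clause_hierFrameGLRec [DecidableEq (PBond (F.P K) k)] (levB : PBond (F.P K) k → ℕ) (a : ℝ)
    (hpos : ∀ x, x ≠ 0 → 0 < RCLike.re ⟪x, laplaceAOfRecord F N k U₀ (QprOfRecord F N k U₀ (hierFrameGLDatumOfRecord F N k U₀)) (QprimeOfRecord F N k U₀) a x⟫_ℂ)
    (hQ : Function.Surjective (QprOfRecord F N k U₀ (hierFrameGLDatumOfRecord F N k U₀)))
    (Gp : SiteL2K ℂ (F.P K).d (fun _ => (F.P K).sitesPerDir 0) (c0Rec F K k) (WRec N) →ₗ[ℂ]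
      SiteL2K ℂ (F.P K).d (fun _ => (F.P K).sitesPerDir 0) (c0Rec F K k) (WRec N))
    {b α nJ : ℝ} (hkpos : 0 < k) (hkm : k ≤ (F.P K).m + (F.P K).K) (hb : 0 ≤ b) (hΩ : ∀ x, x ∈ Ω k) (hαpos : 0 < α) (hα : α * (11000000 * N) ≤ 1)
    (hreg : ∀ j, j < k → PlaqSmall (α * ((F.L : ℝ) ^ j * (F.P K).eta k) ^ 2) (Averaging.iter (avOfRecord F N K) j U₀))
    (hH : Prop4LetterHPrAtRecord F N K k Ω U₀ (hierFrameGLDatumOfRecord F N k U₀) levB a hpos hQ b)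
    -- (KL-H)ᵖʳ
    {hk : Bond (F.P K).d (fun _ => (F.P K).sitesPerDir 0) → PBond (F.P K) k → ℝ} (hk0 : ∀ b' y, 0 ≤ hk b' y)
    (hHk : ∀ (y : PBond (F.P K) k) (Z : Matrix (Fin N) (Fin N) ℂ) (b' : Bond (F.P K).d (fun _ => (F.P K).sitesPerDir 0)),
      ‖flat115 (H1prOfRecordAtBg F N K k Ω U₀ (hierFrameGLDatumOfRecord F N k U₀) levB a hpos hQ
          ((NegSup.equiv (levWeight (F.L : ℝ) ((F.P K).eta k) levB 0) (Matrix (Fin N) (Fin N) ℂ)).symm (Pi.single y Z))) b'‖ ≤ hk b' y * ‖Z‖)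
    {ΘH : ℝ} (hΘH : 0 ≤ ΘH) (hH1 : ∀ y, ∑ b', hk b' y ≤ ΘH) {ΘHw : ℝ} (hΘHw : 0 ≤ ΘHw)
    (hHw : ∀ (bb : Bond (F.P K).d (fun _ => (F.P K).sitesPerDir 0)) (y : PBond (F.P K) k),
      ∑ b', levWeight (F.L : ℝ) ((F.P K).eta k) (bondLevLit F Ω k) 3 bb / levWeight (F.L : ℝ) ((F.P K).eta k) (bondLevLit F Ω k) 3 b' * hk b' y ≤ ΘHw)
    -- (KL-C)ᵖʳ := the (157) clause of `B7.Prop5Printed (kexpOfRecordPr F N 𝔥ᴳᴸ)` at `(α, α₁, C₃)`, `r + r ≤ α₁`, and the window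
    {C₃ α₁ : ℝ} (hC₃ : 0 ≤ C₃)
    (h157 : ∀ (i : KRecIdx F) (U₀ : (kexpOfRecordPr F N (fun K k (U₀ : GaugeField (F.P K) 0 (SU N)) => hierFrameGLDatumOfRecord F N k U₀) i).Cfg), (kexpOfRecordPr F N (fun K k (U₀ : GaugeField (F.P K) 0 (SU N)) => hierFrameGLDatumOfRecord F N k U₀) i).plaqDevEta U₀ < α →
      ∀ A : (kexpOfRecordPr F N (fun K k (U₀ : GaugeField (F.P K) 0 (SU N)) => hierFrameGLDatumOfRecord F N k U₀) i).Fld, (kexpOfRecordPr F N (fun K k (U₀ : GaugeField (F.P K) 0 (SU N)) => hierFrameGLDatumOfRecord F N k U₀) i).fldNorm A < α₁ → (kexpOfRecordPr F N (fun K k (U₀ : GaugeField (F.P K) 0 (SU N)) => hierFrameGLDatumOfRecord F N k U₀) i).dCk U₀ A ≤ C₃ * (kexpOfRecordPr F N (fun K k (U₀ : GaugeField (F.P K) 0 (SU N)) => hierFrameGLDatumOfRecord F N k U₀) i).fldNorm A)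
    (hrα₁ : letI C₂ : ℝ := 281600000000000000 * (F.L : ℝ) * N
      letI c₄ : ℝ := 1 / (200000000000 * (F.L : ℝ) * N)
      letI r : ℝ := min (c₄ / 4) (min (1 / 2) (1 / (16 * (b * C₂ + 1))))
      r + r ≤ α₁)
    (hq : letI C₂ : ℝ := 281600000000000000 * (F.L : ℝ) * N
      letI c₄ : ℝ := 1 / (200000000000 * (F.L : ℝ) * N)
      letI r : ℝ := min (c₄ / 4) (min (1 / 2) (1 / (16 * (b * C₂ + 1))))
      (r + r) * ΘH * (2 * ((F.P K).d : ℝ) * (C₃ * (F.P K).eta k ^ (F.P K).d)) ≤ 1 / 2)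
    -- (KL-N)ᵖʳ
    {hk' : Bond (F.P K).d (fun _ => (F.P K).sitesPerDir 0) → PBond (F.P K) k → ℝ} (hk'0 : ∀ b' y, 0 ≤ hk' b' y)
    (hNk : ∀ (y : PBond (F.P K) k) (Z : Matrix (Fin N) (Fin N) ℂ) (b' : Bond (F.P K).d (fun _ => (F.P K).sitesPerDir 0)),
      ‖NegSup.equiv (levWeight (F.L : ℝ) ((F.P K).eta k) (bondLevLit F Ω k) 3) (Matrix (Fin N) (Fin N) ℂ)
        (DeltaPiCurOfRecord F N K k Ω U₀ Gp (QprimeOfRecord F N k U₀) (H1prOfRecordAtBg F N K k Ω U₀ (hierFrameGLDatumOfRecord F N k U₀) levB a hpos hQ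
          ((NegSup.equiv (levWeight (F.L : ℝ) ((F.P K).eta k) levB 0) (Matrix (Fin N) (Fin N) ℂ)).symm (Pi.single y Z)))) b'‖ ≤ hk' b' y * ‖Z‖)
    {Θ' : ℝ} (hΘ'0 : 0 ≤ Θ')
    (hΘ' : ∀ (bb : Bond (F.P K).d (fun _ => (F.P K).sitesPerDir 0)) (y : PBond (F.P K) k),
      ∑ b', levWeight (F.L : ℝ) ((F.P K).eta k) (bondLevLit F Ω k) 3 bb / levWeight (F.L : ℝ) ((F.P K).eta k) (bondLevLit F Ω k) 1 b' * hk' b' y ≤ Θ')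
    {N₁ : ℝ} (hN₁0 : 0 ≤ N₁)
    (hN₁ : ∀ b', ∑ y, levWeight (F.L : ℝ) ((F.P K).eta k) (bondLevLit F Ω k) 3 b' / levWeight (F.L : ℝ) ((F.P K).eta k) levB 0 y * hk' b' y ≤ N₁)
    (hJ : ‖JOfRecordAtBg F N K k Ω U₀‖ ≤ nJ) :
    letI C₂ : ℝ := 281600000000000000 * (F.L : ℝ) * N
    letI c₄ : ℝ := 1 / (200000000000 * (F.L : ℝ) * N)
    letI r : ℝ := min (c₄ / 4) (min (1 / 2) (1 / (16 * (b * C₂ + 1))))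
    letI R' : ℝ := min r ((1 - 4 * b * C₂ * (r + r)) * (1 / 16))
    letI CV : ℝ := 1024 * (((F.P K).d - 1 : ℕ) : ℝ) * ((1 : ℝ) * 1) ^ 3 * N * (α * (1 : ℝ) ^ 2 + 1 / 16)
        + (((F.P K).d - 1 : ℕ) : ℝ) * ((1 : ℝ) * 1) ^ 3 * (136 + 2 * ((1 : ℝ) * 1)) * N
    letI G : ℝ := 2 * ((F.P K).d : ℝ) * (C₃ * (F.P K).eta k ^ (F.P K).d)
    letI θ₃ : ℝ := (2 * (1 / (1 - 4 * b * C₂ * (r + r))) + 1) * ΘHw * G / r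
    letI θE : ℝ := 2 * ΘHw * G * (1 / (1 - 4 * b * C₂ * (r + r)))
    letI θE' : ℝ := 2 * Θ' * G * (1 / (1 - 4 * b * C₂ * (r + r)))
    Prop4UniformPrAtRecord F N K k Ω U₀ (hierFrameGLDatumOfRecord F N k U₀) levB a hpos hQ r Gp
      ((N * θ₃ * nJ + (N₁ * C₂ * (1 / (1 - 4 * b * C₂ * (r + r))) ^ 2 + N * θE')
        + N * θE * (N₁ * C₂ * (1 / (1 - 4 * b * C₂ * (r + r))) ^ 2) * R'
        + N * (1 + θE * R') * CV * (1 / (1 - 4 * b * C₂ * (r + r))) ^ 2)) R' := by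
  have e : (6400000000000 * (40000 : ℝ) + 25600000000000000) * (F.L : ℝ) * N = 281600000000000000 * (F.L : ℝ) * N := by norm_num
  have h := prop4UniformPrAtRecord_node00_of_prop5Clause_pr_param F N (fun K k (U₀ : GaugeField (F.P K) 0 (SU N)) => hierFrameGLDatumOfRecord F N k U₀) K k Ω U₀ levB a hpos hQ
    Gp hkpos hkm hb hΩ hαpos hα hreg (c𝔥 := 40000) (by norm_num) (by norm_num)
    (C44IterMh.hierFrameGLDatumOfRecord_hdom_of_regular F N k U₀ hαpos.le hα hreg) (C44IterMh.hierFrameGLDatumOfRecord_hnear_of_regular F N k U₀ hαpos.le hα hreg)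
    (C44IterMh.hierFrameGLDatumOfRecord_map_inv_congr_of_eqOn_bondsIn F N k U₀ hkm) (C44IterMh.hierFrameGLDatumOfRecord_deriv_congr_of_eqOn_bondsIn F N k U₀ hkm)
    hH hk0 hHk hΘH hH1 hΘHw hHw hC₃ h157 (by rw [e]; exact hrα₁) (by rw [e]; exact hq) hk'0 hNk hΘ'0 hΘ' hN₁0 hN₁ hJ
  rw [e] at h
  exact h

end Prop4GL

end Summit.QuantumFields.YangMills.Theorems.KExpOfRecordPr

end
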